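import Summits.Ventures.PercRepro.RankLevelSetUpFiveSmall
import Summits.Ventures.PercRepro.RankLevelSetUpNoQuad
import Summits.Ventures.PercRepro.RankLevelSetUpFour

/-! # RankLevelSetUpFive — (↑) AT LEVEL `5` ON EVERY MATROID OF NULLITY `≤ 4` WITH `≥ 12` ELEMENTS, AT EVERY
ELEMENT — UNCONDITIONALLY (night-1 g40; dossier §52; on `RankLevelSetUpFiveSmall`, `RankLevelSetUpNoQuad`,
`RankLevelSetUpFour`)

Strong induction on `#E`: a coloop `c` is removed by `upAt_of_isColoop` (levels `5` and `4` of `M ＼ c`: the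
inductive hypothesis, or the exact middle `#E = 11`, and `upAt_of_nullity_four`) or `upAt_self_of_isColoop` (`b = c`,
with Mono of `M ＼ c`); on a coloop-free matroid of nullity `≤ 3` the chain (`upAt_of_coloopFree_of_nullity_three`);
of nullity `4` without a series quadruple the chain again (`upAt_five_of_no_quad` — this covers every matroid all of
whose series classes have `≤ 3` elements, in particular the series TRIPLES that `RankLevelSetUpFiveSeries` reduced to
the residue (C1), which is therefore not needed); with a series class `P` of `≥ 4` elements: `b ∈ P`
(`upAt_five_of_mem_seriesClass`), `b ∉ P` with `#(E ∖ P) ≤ 8` (`upAt_five_of_seriesClass_small`), and `b ∉ P` with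
`#(E ∖ P) ≥ 9` by the class cut to three elements from the inductive hypothesis
(`upAt_five_of_seriesClass_of_residue`, whose residue hypothesis is vacuous for `q ≥ 4`). Hence
**`upAt_five_of_nullity_four`** and **`upAt_five_of_nullity_le_four`**: `BiIndepUpAt M b 5` for every finite matroid
`M` of nullity `≤ 4` with `12 ≤ #E` and every `b ∈ E`, with **`upAt_of_nullity_four'`** the statement at every level
`k ≤ 5`. No hypothesis beyond finiteness. Every declaration has a docstring; imports: the cell's own modules and
Mathlib only. Axioms: standard. -/

namespace PercRepro

open Set Matroid

variable {α : Type} (M : Matroid α) [M.Finite]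

/-- **(↑) AT LEVEL `5` ON EVERY MATROID OF NULLITY `≤ 4` WITH `≥ 12` ELEMENTS, AT EVERY ELEMENT**: strong induction
on `#E` — coloops removed by `upAt_of_isColoop` / `upAt_self_of_isColoop`; coloop-free of nullity `≤ 3` by the chain;
of nullity `4` without a series quadruple by the chain with the coloop bound `2` (`upAt_five_of_no_quad`); with a
series class of `≥ 4` elements by `upAt_five_of_mem_seriesClass` (`b` inside), `upAt_five_of_seriesClass_small`
(`b` outside, `#(E ∖ P) ≤ 8`) or the class cut to three elements from the inductive hypothesis
(`upAt_five_of_seriesClass_of_residue`, `#(E ∖ P) ≥ 9`; the residue (C1) is only asked for classes of exactly three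
elements, which do not occur here). -/
theorem upAt_five_of_nullity_four :
    ∀ n : ℕ, ∀ (M' : Matroid α) [M'.Finite], M'.E.ncard = n → M'✶.eRank ≤ 4 → 12 ≤ n →
      ∀ b ∈ M'.E, BiIndepUpAt M' b 5 := by
  intro n
  induction n using Nat.strong_induction_on with
  | _ n ih =>
    intro M' _ hn hν h12 b hb
    by_cases hcol : ∃ c, M'.IsColoop c
    · obtain ⟨c, hc⟩ := hcol
      haveI := delete_finite' M' c
      have hcard : (M'.delete {c}).E.ncard = n - 1 := by
        rw [Matroid.delete_ground, Set.ncard_sdiff_singleton_of_mem hc.mem_ground, hn]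
      have hν' : (M'.delete {c})✶.eRank ≤ 4 := (eRank_dual_delete_isColoop_le M' hc).trans hν
      by_cases hbc : b = c
      · subst hbc
        exact upAt_self_of_isColoop M' hc (k := 4) (by omega) (biIndepMono_of_nullity (M'.delete {b}) hν')
      · have hbM : b ∈ (M'.delete {c}).E := by
          rw [Matroid.delete_ground]; exact ⟨hb, by simpa using hbc⟩
        refine upAt_of_isColoop M' hc hbc (k := 4) ?_ ?_
        · rcases Nat.lt_or_ge 12 n with hlt | hge
          · exact ih (n - 1) (by omega) (M'.delete {c}) hcard hν' (by omega) b hbM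
          · -- `#E = 12`: the deletion has `11` elements, the exact middle of level `5`
            exact upAt_of_ncard_eq_middle (M'.delete {c}) hbM (k := 5) (by rw [hcard]; omega)
        · exact upAt_of_nullity_four (n - 1) (M'.delete {c}) hcard hν' 4 le_rfl (by omega) b hbM
    · simp only [not_exists] at hcol
      by_cases h3 : M'✶.eRank ≤ 3
      · exact upAt_of_coloopFree_of_nullity_three M' hcol h3 hb (by omega)
      · have h4 : M'✶.eRank = 4 := eRank_dual_eq_four_of_not_le_three M' hν h3
        by_cases hnq : NoSeriesQuad M'
        · exact upAt_five_of_no_quad M' hcol hν hnq hb (by omega)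
        · obtain ⟨p, hp, hq⟩ := four_le_ncard_seriesClass_of_not_noSeriesQuad M' hnq
          by_cases hbP : b ∈ M'✶.closure {p}
          · exact upAt_five_of_mem_seriesClass M' hcol h4 hp hq hbP (by omega)
          · rcases Nat.lt_or_ge (M'.E \ M'✶.closure {p}).ncard 9 with hlt | hge
            · exact upAt_five_of_seriesClass_small M' hcol h4 hp hq hb hbP (by omega) (by omega)
            · refine upAt_five_of_seriesClass_of_residue M' hcol h4 hp (by omega) hb hbP hge ?_ ?_
              · intro M'' _ hlt' hν'' h12' b'' hb''
                exact ih M''.E.ncard (by omega) M'' rfl hν'' h12' b'' hb''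
              · intro h3'
                omega

/-- **(↑) AT LEVEL `5` ON EVERY MATROID OF NULLITY `≤ 4` WITH `≥ 12` ELEMENTS, AT EVERY ELEMENT.** -/
theorem upAt_five_of_nullity_le_four (hν : M✶.eRank ≤ 4) (hn : 12 ≤ M.E.ncard) {b : α} (hb : b ∈ M.E) :
    BiIndepUpAt M b 5 :=
  upAt_five_of_nullity_four M.E.ncard M rfl hν hn b hb

/-- **(↑) AT EVERY LEVEL `k ≤ 5` WITH `2k + 2 ≤ #E` ON EVERY MATROID OF NULLITY `≤ 4`, AT EVERY ELEMENT**
(`upAt_of_nullity_four` for `k ≤ 4`, `upAt_five_of_nullity_le_four` for `k = 5`). -/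
theorem upAt_of_nullity_four' (hν : M✶.eRank ≤ 4) {k : ℕ} (hk5 : k ≤ 5) (hk : 2 * k + 2 ≤ M.E.ncard) {b : α}
    (hb : b ∈ M.E) : BiIndepUpAt M b k := by
  rcases Nat.lt_or_ge k 5 with hk4 | hk5'
  · exact upAt_of_nullity_four M.E.ncard M rfl hν k (by omega) hk b hb
  · have : k = 5 := by omega
    subst this
    exact upAt_five_of_nullity_le_four M hν (by omega) hb

end PercRepro
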